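import Summits.QuantumFields.YangMills.Theorems.ColdStartUniversalityLatticeLangevinDoeblinHaarAllTimes
import HarnessLib

/-!
# Route `ColdStartUniversality` (fixed-cut-off package): at every lattice time `t > 0` the SU(2) Langevin transition laws are
# EQUIVALENT TO HAAR and charge every non-empty open set (irreducibility / full support at fixed cut-off)

Helper file (seat `ym-line-csu-p1`, g12, free hands).  Corollaries of the all-times Doeblin minorisation `doeblin_szz_haar_of_pos`
(`c · Haar^{⊗E} ≤ κ_t(z, ·)`) and of the absolute continuity `map_absolutelyContinuous_haar` of the time-`t` laws, for THE transition
kernels `κ_t` of `exists_transitionKernel` (any `β'`):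

* `kernel_absolutelyContinuous_haar` — `κ_t(z, ·) ≪ Haar^{⊗E}`;
* ★ `haar_absolutelyContinuous_kernel` — `Haar^{⊗E} ≪ κ_t(z, ·)` (so the two are equivalent measures, `t > 0`);
* ★ `kernel_apply_pos_of_isOpen` — `κ_t(z, O) > 0` for every non-empty open `O ⊆ SU(2)^E` and every start `z` (topological
  irreducibility and aperiodicity of every skeleton chain at fixed cut-off).

THEOREMS ONLY, [folklore]; RECORD-rung R3 plumbing; no crux, rung or summit is proved here; the Yang–Mills mass gap is NOT proved.
-/

set_option autoImplicit false

noncomputable section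

namespace Summit.QuantumFields.YangMills.Theorems.ColdStartUniversality

open MeasureTheory ProbabilityTheory Filter
open scoped NNReal ENNReal BigOperators
open Literature.Probability.Process Literature.MathematicalPhysics.QuantumFieldTheory
open Literature.MathematicalPhysics.QuantumLattice (fundamentalRep fundamentalLatticeRep)

variable {L : ℕ} [NeZero L]

/-- `κ_t(z, ·) ≪ Haar^{⊗E}` for the SZZ transition kernels, `t > 0`. [folklore] -/
theorem kernel_absolutelyContinuous_haar (β' : ℝ)
    (κ : ℝ≥0 → Kernel (GaugeConfig 3 L (Matrix.specialUnitaryGroup (Fin 2) ℂ))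
      (GaugeConfig 3 L (Matrix.specialUnitaryGroup (Fin 2) ℂ)))
    (hreal : ∀ (t : ℝ≥0) (x : GaugeConfig 3 L (Matrix.specialUnitaryGroup (Fin 2) ℂ))
        (Ω : Type) [MeasurableSpace Ω] (P : Measure Ω) [IsProbabilityMeasure P]
        (W : ℝ≥0 → Ω → (Edge 3 L × NoiseIdx 2 → ℝ)) (hW : IsFlatBrownian W P)
        (U : ℝ≥0 → Ω → GaugeConfig 3 L (Matrix.specialUnitaryGroup (Fin 2) ℂ)),
        (∀ ω, U 0 ω = x) →
        (latticeLangevinDynamics (fundamentalLatticeRep 2) β').IsSolution (fundamentalRep (Fin 2))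
          hW.natFiltration P W U →
        κ t x = P.map (U t))
    {t : ℝ≥0} (ht : 0 < (t : ℝ)) (z : GaugeConfig 3 L (Matrix.specialUnitaryGroup (Fin 2) ℂ)) :
    κ t z ≪ Measure.pi fun _ : Edge 3 L => haarProbability (Matrix.specialUnitaryGroup (Fin 2) ℂ) := by
  classical
  haveI := isProbabilityMeasure_piWiener (Edge 3 L × NoiseIdx 2)
  have hWc := isFlatBrownian_piWiener 3 L (NoiseIdx 2)
  obtain ⟨X, GX, hX, -, -, -, -⟩ := exists_regularFlow L β' hWc
  rw [hreal t z _ _ _ hWc (X z) (hX z).1 (hX z).2]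
  exact map_absolutelyContinuous_haar (L := L) β' ht z hWc (hX z).1 (hX z).2

/-- ★ **Haar is absolutely continuous with respect to every transition law**: `Haar^{⊗E} ≪ κ_t(z, ·)` for `t > 0` and every
start `z` (Doeblin minorisation at time `t`). [folklore] -/
theorem haar_absolutelyContinuous_kernel (β' : ℝ)
    (κ : ℝ≥0 → Kernel (GaugeConfig 3 L (Matrix.specialUnitaryGroup (Fin 2) ℂ))
      (GaugeConfig 3 L (Matrix.specialUnitaryGroup (Fin 2) ℂ))) [∀ t, IsMarkovKernel (κ t)]
    (hreal : ∀ (t : ℝ≥0) (x : GaugeConfig 3 L (Matrix.specialUnitaryGroup (Fin 2) ℂ))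
        (Ω : Type) [MeasurableSpace Ω] (P : Measure Ω) [IsProbabilityMeasure P]
        (W : ℝ≥0 → Ω → (Edge 3 L × NoiseIdx 2 → ℝ)) (hW : IsFlatBrownian W P)
        (U : ℝ≥0 → Ω → GaugeConfig 3 L (Matrix.specialUnitaryGroup (Fin 2) ℂ)),
        (∀ ω, U 0 ω = x) →
        (latticeLangevinDynamics (fundamentalLatticeRep 2) β').IsSolution (fundamentalRep (Fin 2))
          hW.natFiltration P W U →
        κ t x = P.map (U t))
    {t : ℝ≥0} (ht : 0 < (t : ℝ)) (z : GaugeConfig 3 L (Matrix.specialUnitaryGroup (Fin 2) ℂ)) :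
    (Measure.pi fun _ : Edge 3 L => haarProbability (Matrix.specialUnitaryGroup (Fin 2) ℂ)) ≪ κ t z := by
  obtain ⟨c, hc0, -, hmin⟩ := doeblin_szz_haar_of_pos (L := L) β' κ hreal (t₀ := t) ht
  refine Measure.AbsolutelyContinuous.mk fun s _ hs => ?_
  have h := Measure.le_iff'.1 (hmin z t le_rfl) s
  rw [hs, Measure.smul_apply, smul_eq_mul, nonpos_iff_eq_zero, mul_eq_zero] at h
  rcases h with h | h
  · exact absurd h (by rw [ENNReal.ofReal_eq_zero, not_le]; exact hc0)
  · exact h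

/-- ★ **Every transition law charges every non-empty open set**: `κ_t(z, O) > 0` for `t > 0`, `O` open non-empty, every `z`
(topological irreducibility at fixed cut-off). [folklore] -/
theorem kernel_apply_pos_of_isOpen (β' : ℝ)
    (κ : ℝ≥0 → Kernel (GaugeConfig 3 L (Matrix.specialUnitaryGroup (Fin 2) ℂ))
      (GaugeConfig 3 L (Matrix.specialUnitaryGroup (Fin 2) ℂ))) [∀ t, IsMarkovKernel (κ t)]
    (hreal : ∀ (t : ℝ≥0) (x : GaugeConfig 3 L (Matrix.specialUnitaryGroup (Fin 2) ℂ))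
        (Ω : Type) [MeasurableSpace Ω] (P : Measure Ω) [IsProbabilityMeasure P]
        (W : ℝ≥0 → Ω → (Edge 3 L × NoiseIdx 2 → ℝ)) (hW : IsFlatBrownian W P)
        (U : ℝ≥0 → Ω → GaugeConfig 3 L (Matrix.specialUnitaryGroup (Fin 2) ℂ)),
        (∀ ω, U 0 ω = x) →
        (latticeLangevinDynamics (fundamentalLatticeRep 2) β').IsSolution (fundamentalRep (Fin 2))
          hW.natFiltration P W U →
        κ t x = P.map (U t))
    {t : ℝ≥0} (ht : 0 < (t : ℝ)) (z : GaugeConfig 3 L (Matrix.specialUnitaryGroup (Fin 2) ℂ))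
    {O : Set (GaugeConfig 3 L (Matrix.specialUnitaryGroup (Fin 2) ℂ))} (hO : IsOpen O) (hne : O.Nonempty) :
    0 < κ t z O := by
  classical
  set H : Measure (GaugeConfig 3 L (Matrix.specialUnitaryGroup (Fin 2) ℂ)) :=
    Measure.pi fun _ : Edge 3 L => haarProbability (Matrix.specialUnitaryGroup (Fin 2) ℂ) with hH
  haveI : H.IsOpenPosMeasure := by
    rw [hH]
    haveI : ∀ _e : Edge 3 L, (haarProbability (Matrix.specialUnitaryGroup (Fin 2) ℂ)).IsOpenPosMeasure := fun _ => by
      unfold haarProbability; infer_instance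
    infer_instance
  have hHO : 0 < H O := hO.measure_pos H hne
  have hac := haar_absolutelyContinuous_kernel (L := L) β' κ hreal ht z
  rw [← hH] at hac
  exact pos_iff_ne_zero.2 fun h0 => hHO.ne' (hac h0)

end Summit.QuantumFields.YangMills.Theorems.ColdStartUniversality

end
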